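import Literature.NumberTheory.EllipticCurves.BSDSelmerSmithAssumption
import Literature.NumberTheory.EllipticCurves.BSDSelmerSmithCasesExplicitProofs
import Literature.NumberTheory.EllipticCurves.BSDSelmerSmithNormalisationProofs
import HarnessLib

/-!
# [Smi22a] Assumption 1.1 is "Case I or Case II" of arXiv:2503.17619; Thm. 1.1 from [Smi22a],
# Thm. 1.2 verbatim

A `…Proofs` companion (theorems only, no new definitions, no named facts) of
`BSDSelmerSmithAssumption` (`smi22aAssumption`, A. Smith, arXiv:2207.05674 [Smi22a],
Assumption 1.1) and of the case split `smithCaseI`–`smithCaseV` (A. Smith, arXiv:2503.17619,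
Def. 1.6, `BSDSelmerSmithCases`). It supplies the step left implicit in arXiv:2503.17619, §1.1 —
*"If `E` is in Case I or Case II, Theorem 1.1 follows for `E` from [Smi22a]"* — namely that the
standing hypothesis of [Smi22a] covers exactly Cases I and II:

* §1 `ker ρ̄_{E,n}` is invariant under isogenies bijective on `ℚ̄`-points; two degree-`2`
  isogenies out of a curve with `E(ℚ)[2] ≅ ℤ/2ℤ` have targets with the same `ℚ(E_0[2])`
  (`ker_galoisRepTorsion_eq_of_degree_eq_two`: "the unique degree-`2` isogeny").
* §2 **Branch (2) of Assumption 1.1 ⟺ Case II** (`forall_of_smithCaseII`,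
  `smithCaseII_of_forall`): the universal reading over all degree-`2` isogenies and the
  existential reading of Def. 1.6 agree.
* §3 **For `E(ℚ)[2] ≅ (ℤ/2ℤ)²`: `E` has a cyclic degree-`4` isogeny over `ℚ` iff `E` has a balanced
  isogeny** (`exists_isBalanced_of_isCyclic`, `exists_isCyclic_of_isBalanced`). If
  `ψ : E → E''` is cyclic of degree `4` with `ker ψ = ⟨P⟩`, the `2`-isogeny `φ : E → E/⟨2P⟩` is
  balanced: every point of `(E/⟨2P⟩)[2] = φ(½⟨2P⟩)` is `φ(R)` with `2R ∈ {O, 2P}`, and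
  `σR - R ∈ ⟨P⟩[2] = ⟨2P⟩ = ker φ` because `⟨P⟩` is `Γ_ℚ`-stable. Conversely, if `φ : E → E_0`
  is balanced then `E_0(ℚ)[2] = E_0[2]`; for `Q ∈ E` with `2Q = S`, `ker φ = {O, S}`, the point
  `Q' = φ(Q) ∈ E_0(ℚ)[2]` spans the kernel of a `2`-isogeny `φ₂ : E_0 → E''` over `ℚ`, and
  `ker (φ₂ ∘ φ) = {O, S, Q, Q + S} = ⟨Q⟩ ≅ ℤ/4ℤ`. (Equivalently: a rational cyclic `4`-subgroup
  `C ∋ T` exists iff `E/⟨T⟩` acquires full rational `2`-torsion, Silverman, *AEC*, III.4.12.)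
* §4 **`smi22aAssumption E ↔ smithCaseI E ∨ smithCaseII E`** for every elliptic `E/ℚ`
  (`smi22aAssumption_iff_smithCaseI_or_smithCaseII`).
* §4b **The five cases of Def. 1.6 are pairwise disjoint** (Cases I, II, III carry no balanced
  isogeny; the ten exclusions `not_smithCase…_of_smithCase…`), so with `smithCase_exhaustive`
  Def. 1.6 is a partition; hence **Assumption 1.1 ⟺ `E` is in none of Cases III, IV, V ⟺ `E` has
  no balanced isogeny and is not in Case III** (`smi22aAssumption_iff_not_smithCaseIII_IV_V`,
  `smi22aAssumption_iff_forall_not_isBalanced`) — the precise sense of "for that theorem, we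
  needed to assume that `E` did not have a balanced isogeny" (arXiv:2503.17619, §1.1).
* §6 Examples: Assumption 1.1 holds for the Case I and Case II examples of
  `BSDSelmerSmithCasesExplicitProofs` and fails for the Case III, IV, V examples — curves covered
  by arXiv:2503.17619, Thm. 1.1 but not by [Smi22a], Thm. 1.2.
* §5 **Thm. 1.1 of arXiv:2503.17619 for every elliptic curve over `ℚ` from [Smi22a], Thm. 1.2
  taken verbatim** (its printed display, for every elliptic `A/ℚ` satisfying Assumption 1.1)
  together with the two printed conclusions of Thm. 1.17 and the tree facts `exists_isNewformOf`,
  `monsky_selmerCorank_two_mod_two_eq` (`smith_selmerCorank_density_of_smi22a`): the assembly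
  `smith_selmerCorank_density_of_printed_inputs'` (`BSDSelmerSmithCaseVProofs`) with its input
  `hSmi` now literally the main theorem of [Smi22a].

Nothing here proves [Smi22a], Thm. 1.2 or Thm. 1.17 of arXiv:2503.17619; no named fact is
introduced and `smith_selmerCorank_density` is not weakened.

## References

* [Smith2022SelmerTwistI] A. Smith, arXiv:2207.05674 (2022), §1.1, Assumption 1.1, Thm. 1.2.
* [arXiv250317619] A. Smith, arXiv:2503.17619 (2025), §1.1 (Def. 1.6; proof of Thm. 1.1).
* [SilvermanAEC2009] J. H. Silverman, *The Arithmetic of Elliptic Curves*, 2nd ed., III.4.11,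
  III.4.12, Rem. III.4.13.2.
-/

noncomputable section

open scoped Classical

namespace WeierstrassCurve

open Literature.NumberTheory.EllipticCurves

/-! ## §1 `ℚ(E[n])` along bijective isogenies; the unique degree-`2` quotient -/

section Transport

variable {K : Type*} [Field K]

/-- **`K(E[n])` is an isomorphism invariant**: along an isogeny `λ : E → E'` over `K` which is
bijective on `K̄`-points, `ker ρ̄_{E,n} = ker ρ̄_{E',n}` (`λ` restricts to a `Γ_K`-equivariant
bijection `E[n] → E'[n]`). [folklore] -/
theorem ker_galoisRepTorsion_eq_of_bijective {W W' : WeierstrassCurve K} (lam : Isogeny W W')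
    (hbij : Function.Bijective lam) (n : ℤ) :
    (W.galoisRepTorsion n).ker = (W'.galoisRepTorsion n).ker := by
  ext σ
  rw [mem_ker_galoisRepTorsion_iff', mem_ker_galoisRepTorsion_iff']
  constructor
  · intro h P' hP'
    obtain ⟨P, rfl⟩ := hbij.2 P'
    have hP : n • P = 0 := hbij.1 (by rw [map_zsmul, hP', map_zero])
    rw [← lam.map_smul, h P hP]
  · intro h P hP
    apply hbij.1
    rw [lam.map_smul]
    exact h (lam P) (by rw [← map_zsmul, hP, map_zero])

end Transport

section UniqueQuotient

variable (W : WeierstrassCurve ℚ) [W.IsElliptic]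

/-- **"The unique degree-`2` `ℚ`-isogeny"**: if `#E(ℚ)[2] = 2`, the targets of any two degree-`2`
`ℚ`-isogenies `φ₀ : E → E_0`, `φ₁ : E → E_1` (elliptic models) are `ℚ`-isomorphic, whence
`ℚ(E_0[n]) = ℚ(E_1[n])`: both factor through the quotient `g : E → E/E(ℚ)[2]` by isogenies
bijective on `ℚ̄`-points (Silverman, *AEC*, III.4.11–4.12). [cite: SilvermanAEC2009, Cor. III.4.11] -/
theorem ker_galoisRepTorsion_eq_of_degree_eq_two (h2 : ratTwoTorsionCard W = 2)
    {W₀ W₁ : WeierstrassCurve ℚ} [W₀.IsElliptic] [W₁.IsElliptic] (φ₀ : Isogeny W W₀)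
    (φ₁ : Isogeny W W₁) (h₀ : φ₀.degree = 2) (h₁ : φ₁.degree = 2) (n : ℤ) :
    (W₀.galoisRepTorsion n).ker = (W₁.galoisRepTorsion n).ker := by
  obtain ⟨Q, hQ0, hQ, hkerφ₀⟩ := φ₀.exists_ker_eq_zmultiples_of_degree_eq_two h₀
  obtain ⟨B, _, g, f, hkerg, hdeg, -, hgf⟩ := exists_isogeny_degree_two_of_fixed W hQ0 hQ
  have hk₀ : g.toAddMonoidHom.ker = φ₀.toAddMonoidHom.ker := by rw [hkerg, hkerφ₀]
  have hk₁ : g.toAddMonoidHom.ker = φ₁.toAddMonoidHom.ker :=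
    Isogeny.ker_eq_ker_of_degree_eq_two W h2 g φ₁ hdeg h₁
  have hgf' : ∀ P', g (f P') = 2 • P' := fun P' ↦ by rw [hgf P', ← natCast_zsmul]; rfl
  have key : ∀ {W' : WeierstrassCurve ℚ} [W'.IsElliptic] (φ : Isogeny W W'),
      g.toAddMonoidHom.ker = φ.toAddMonoidHom.ker →
        (B.galoisRepTorsion n).ker = (W'.galoisRepTorsion n).ker := by
    intro W' _ φ hk
    have hle : ∀ P, g P = 0 → φ P = 0 := fun P hP ↦ by
      have h : P ∈ g.toAddMonoidHom.ker := by rwa [AddMonoidHom.mem_ker]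
      rw [hk] at h
      rwa [AddMonoidHom.mem_ker] at h
    have hge : ∀ P, φ P = 0 → g P = 0 := fun P hP ↦ by
      have h : P ∈ φ.toAddMonoidHom.ker := by rwa [AddMonoidHom.mem_ker]
      rw [← hk] at h
      rwa [AddMonoidHom.mem_ker] at h
    obtain ⟨lam, hlam⟩ := Isogeny.exists_factor_of_ker_le two_ne_zero g f hgf' φ hle
    exact ker_galoisRepTorsion_eq_of_bijective lam
      ⟨Isogeny.injective_of_factor g φ lam hlam hge, Isogeny.surjective_of_factor g φ lam hlam⟩ n
  rw [← key φ₀ hk₀, ← key φ₁ hk₁]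

end UniqueQuotient

end WeierstrassCurve

namespace Literature.NumberTheory.EllipticCurves

open WeierstrassCurve

/-! ## §2 Branch (2) of Assumption 1.1 ⟺ Case II -/

section CaseTwo

variable (W : WeierstrassCurve ℚ) [W.IsElliptic]

/-- **Case II ⟹ branch (2) of [Smi22a], Assumption 1.1**: if `#E(ℚ)[2] = 2` and some degree-`2`
isogeny `φ₁ : E → E_1` is not balanced with `#E_1(ℚ)[2] ≠ 4`, then *every* degree-`2` isogeny
`φ : E → E_0` has `ℚ(E_0[2]) ≠ ℚ` and `ℚ(E_0[2]) ≠ ℚ(E[2])` (the target is unique up to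
`ℚ`-isomorphism, §1). [cite: Smith2022SelmerTwistI, Assumption 1.1] -/
theorem forall_of_smithCaseII (h : smithCaseII W) (W₀ : WeierstrassCurve ℚ) [W₀.IsElliptic]
    (φ : Isogeny W W₀) (hφ : φ.degree = 2) :
    (W₀.galoisRepTorsion 2).ker ≠ ⊤ ∧ (W₀.galoisRepTorsion 2).ker ≠ (W.galoisRepTorsion 2).ker := by
  obtain ⟨h2, W₁, _, φ₁, hd₁, hnb, hc₁⟩ := h
  have hk : (W₀.galoisRepTorsion 2).ker = (W₁.galoisRepTorsion 2).ker :=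
    ker_galoisRepTorsion_eq_of_degree_eq_two W h2 φ φ₁ hφ hd₁ 2
  refine ⟨fun htop ↦ hc₁ (ratTwoTorsionCard_eq_four_of_ker_eq_top W₁ (hk ▸ htop)), fun he ↦ ?_⟩
  exact hnb ⟨hd₁, by rw [← hk, he]⟩

/-- A curve with `#E(ℚ)[2] = 2` has a nonzero `Γ_ℚ`-fixed point of `E[2]`. [folklore] -/
theorem exists_fixed_of_ratTwoTorsionCard_eq_two {W : WeierstrassCurve ℚ}
    (h2 : ratTwoTorsionCard W = 2) :
    ∃ Q : geomTorsion W (2 : ℤ), Q ≠ 0 ∧ ∀ σ : Field.absoluteGaloisGroup ℚ, σ • Q = Q := by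
  rw [ratTwoTorsionCard] at h2
  obtain ⟨y, hy, -⟩ := (Nat.card_eq_two_iff'
    (⟨0, fun σ ↦ smul_zero σ⟩ : MulAction.fixedPoints (Field.absoluteGaloisGroup ℚ)
      (geomTorsion W (2 : ℤ)))).mp h2
  exact ⟨y.1, fun e ↦ hy (Subtype.ext e), fun σ ↦ y.2 σ⟩

/-- **Branch (2) of [Smi22a], Assumption 1.1 ⟹ Case II**: with `#E(ℚ)[2] = 2`, the quotient
`φ : E → E_0 = E/E(ℚ)[2]` (tree `exists_isogeny_degree_two_of_fixed`) is a degree-`2` isogeny to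
an elliptic curve; `ℚ(E_0[2]) ≠ ℚ(E[2])` says it is not balanced and `ℚ(E_0[2]) ≠ ℚ` says
`#E_0(ℚ)[2] ≠ 4`. [cite: Smith2022SelmerTwistI, Assumption 1.1] -/
theorem smithCaseII_of_forall (h2 : ratTwoTorsionCard W = 2)
    (h : ∀ (W₀ : WeierstrassCurve ℚ) [W₀.IsElliptic] (φ : Isogeny W W₀), φ.degree = 2 →
      (W₀.galoisRepTorsion 2).ker ≠ ⊤ ∧ (W₀.galoisRepTorsion 2).ker ≠ (W.galoisRepTorsion 2).ker) :
    smithCaseII W := by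
  obtain ⟨Q, hQ0, hQ⟩ := exists_fixed_of_ratTwoTorsionCard_eq_two h2
  obtain ⟨W₀, hW₀, φ, -, -, hd, -, -⟩ := exists_isogeny_degree_two_of_fixed W hQ0 hQ
  obtain ⟨htop, hne⟩ := h W₀ φ hd
  refine ⟨h2, W₀, hW₀, φ, hd, fun hb ↦ hne hb.2.symm, fun h4 ↦ ?_⟩
  exact htop (ker_galoisRepTorsion_two_eq_top_of_ratTwoTorsionCard_eq_four W₀ h4)

/-- **Case II ⟺ `#E(ℚ)[2] = 2` and branch (2) of [Smi22a], Assumption 1.1.**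
[cite: Smith2022SelmerTwistI, Assumption 1.1] [cite: arXiv250317619, Def. 1.6] -/
theorem smithCaseII_iff_forall :
    smithCaseII W ↔ ratTwoTorsionCard W = 2 ∧
      ∀ (W₀ : WeierstrassCurve ℚ) [W₀.IsElliptic] (φ : Isogeny W W₀), φ.degree = 2 →
        (W₀.galoisRepTorsion 2).ker ≠ ⊤ ∧
          (W₀.galoisRepTorsion 2).ker ≠ (W.galoisRepTorsion 2).ker :=
  ⟨fun h ↦ ⟨h.1, fun W₀ _ φ hφ ↦ forall_of_smithCaseII W h W₀ φ hφ⟩,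
    fun h ↦ smithCaseII_of_forall W h.1 fun W₀ _ φ hφ ↦ h.2 W₀ φ hφ⟩

end CaseTwo

/-! ## §3 Full rational `2`-torsion: cyclic degree-`4` isogenies ⟺ balanced isogenies -/

section CyclicFour

/-- In `⟨T⟩` with `2T = O`, `T ≠ O`, every element is `O` or `T`. [folklore] -/
theorem eq_zero_or_eq_of_mem_zmultiples_of_two_zsmul {A : Type*} [AddGroup A] {T x : A}
    (hT0 : T ≠ 0) (hT2 : (2 : ℤ) • T = 0) (hx : x ∈ AddSubgroup.zmultiples T) :
    x = 0 ∨ x = T := by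
  obtain ⟨k, rfl⟩ := AddSubgroup.mem_zmultiples_iff.mp hx
  have hT2' : (2 : ℕ) • T = 0 := by exact_mod_cast hT2
  have ho : addOrderOf T = 2 := addOrderOf_eq_prime hT2' hT0
  rw [← mod_addOrderOf_zsmul T k, ho]
  push_cast
  rcases Int.emod_two_eq_zero_or_one k with h | h
  · exact Or.inl (by rw [h, zero_zsmul])
  · exact Or.inr (by rw [h, one_zsmul])

/-- In `⟨P⟩` with `P` of order `4`, the elements killed by `2` are `O` and `2P`. [folklore] -/
theorem eq_zero_or_eq_two_zsmul_of_mem_zmultiples {A : Type*} [AddGroup A] {P x : A}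
    (hP : addOrderOf P = 4) (hx : x ∈ AddSubgroup.zmultiples P) (h2 : (2 : ℤ) • x = 0) :
    x = 0 ∨ x = (2 : ℤ) • P := by
  obtain ⟨k, rfl⟩ := AddSubgroup.mem_zmultiples_iff.mp hx
  have h0 : (2 * k) • P = 0 := by rwa [mul_zsmul]
  have hdvd : (addOrderOf P : ℤ) ∣ 2 * k := addOrderOf_dvd_iff_zsmul_eq_zero.mpr h0
  rw [hP] at hdvd
  push_cast at hdvd
  have hk : k % 4 = 0 ∨ k % 4 = 2 := by omega
  rw [← mod_addOrderOf_zsmul P k, hP]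
  push_cast
  rcases hk with h | h
  · exact Or.inl (by rw [h, zero_zsmul])
  · exact Or.inr (by rw [h])

/-- `σ • (n • P) = n • (σ • P)` for the Galois action on `E(ℚ̄)`. [folklore] -/
theorem galois_smul_zsmul (W : WeierstrassCurve ℚ) (σ : Field.absoluteGaloisGroup ℚ) (n : ℤ)
    (P : W.geomPoints) : σ • (n • P) = n • (σ • P) :=
  map_zsmul (DistribSMul.toAddMonoidHom W.geomPoints σ) n P

variable (W : WeierstrassCurve ℚ) [W.IsElliptic]

/-- **A cyclic degree-`4` isogeny over `ℚ` on a curve with full rational `2`-torsion yields a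
balanced isogeny.** If `ψ : E → E''` is a `ℚ`-isogeny with `ker ψ = ⟨P⟩ ≅ ℤ/4ℤ`, put `T = 2P`
(a rational point of order `2`) and let `φ : E → E_0 = E/⟨T⟩` be the degree-`2` quotient
(Silverman, *AEC*, III.4.12; tree `exists_isogeny_degree_two_of_fixed`). Then
`ℚ(E_0[2]) = ℚ = ℚ(E[2])`: a point of `E_0[2]` is `φ(R)` with `2R ∈ ker φ = {O, T}`; if
`2R = O` then `R ∈ E[2] = E(ℚ)[2]`, and if `2R = T = 2P` then `R - P ∈ E[2]` is rational while
`σP - P ∈ ⟨P⟩` (the kernel of a `ℚ`-isogeny is `Γ_ℚ`-stable) is killed by `2`, so lies in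
`{O, T} = ker φ`; either way `σ(φ R) = φ(σ R) = φ(R)`.
[cite: Smith2022SelmerTwistI, Assumption 1.1] [cite: SilvermanAEC2009, Prop. III.4.12] -/
theorem exists_isBalanced_of_isCyclic (h4 : ratTwoTorsionCard W = 4) {W'' : WeierstrassCurve ℚ}
    (ψ : Isogeny W W'') (hc : ψ.IsCyclic) (hd : ψ.degree = 4) :
    ∃ (W₀ : WeierstrassCurve ℚ) (_ : W₀.IsElliptic) (φ : Isogeny W W₀), φ.IsBalanced := by
  have hkerW := ker_galoisRepTorsion_two_eq_top_of_ratTwoTorsionCard_eq_four W h4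
  have hfix := (ker_galoisRepTorsion_eq_top_iff W 2).mp hkerW
  -- a generator `P` of `ker ψ`, of order `4`
  haveI : IsAddCyclic ψ.toAddMonoidHom.ker := hc
  obtain ⟨g, hg⟩ := IsAddCyclic.exists_ofOrder_eq_natCard (α := ψ.toAddMonoidHom.ker)
  set P : W.geomPoints := (g : W.geomPoints) with hP_def
  have hPo : addOrderOf P = 4 := by
    rw [hP_def, AddSubgroup.addOrderOf_coe, hg]; exact hd
  have hgen : ∀ X : W.geomPoints, ψ X = 0 → X ∈ AddSubgroup.zmultiples P := by
    intro X hX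
    have htop : AddSubgroup.zmultiples g = ⊤ := by
      apply AddSubgroup.eq_top_of_card_eq
      rw [Nat.card_zmultiples, hg]
    have hXm : (⟨X, by rwa [AddMonoidHom.mem_ker]⟩ : ψ.toAddMonoidHom.ker) ∈
        AddSubgroup.zmultiples g := by
      rw [htop]; exact AddSubgroup.mem_top _
    obtain ⟨k, hk⟩ := AddSubgroup.mem_zmultiples_iff.mp hXm
    exact AddSubgroup.mem_zmultiples_iff.mpr ⟨k, by simpa [hP_def] using congrArg Subtype.val hk⟩
  have hP0 : ψ P = 0 := by
    have h := g.2
    rwa [AddMonoidHom.mem_ker] at h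
  -- `T = 2P`: nonzero, killed by `2`, fixed by `Γ_ℚ`
  have hT0 : (2 : ℤ) • P ≠ 0 := by
    have h := nsmul_ne_zero_of_lt_addOrderOf (x := P) (n := 2) two_ne_zero (by rw [hPo]; norm_num)
    exact_mod_cast h
  have hT2 : (2 : ℤ) • (2 : ℤ) • P = 0 := by
    have h : ((4 : ℕ) : ℤ) • P = 0 := by
      rw [natCast_zsmul, ← hPo]; exact addOrderOf_nsmul_eq_zero P
    rw [← mul_zsmul, show (2 : ℤ) * 2 = ((4 : ℕ) : ℤ) by norm_num, h]
  have hTσ : ∀ σ : Field.absoluteGaloisGroup ℚ, σ • ((2 : ℤ) • P) = (2 : ℤ) • P := fun σ ↦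
    hfix σ _ hT2
  set Tt : geomTorsion W (2 : ℤ) := ⟨(2 : ℤ) • P, (Submodule.mem_torsionBy_iff _ _).mpr hT2⟩
    with hTt_def
  have hTt0 : Tt ≠ 0 := fun e ↦ hT0 (congrArg Subtype.val e)
  have hTt : ∀ σ : Field.absoluteGaloisGroup ℚ, σ • Tt = Tt := fun σ ↦ Subtype.ext (hTσ σ)
  obtain ⟨W₀, hW₀, φ, -, hkerφ, hdeg, -, -⟩ := exists_isogeny_degree_two_of_fixed W hTt0 hTt
  refine ⟨W₀, hW₀, φ, hdeg, ?_⟩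
  have hmemφ : ∀ X, φ X = 0 ↔ X ∈ AddSubgroup.zmultiples ((2 : ℤ) • P) := fun X ↦ by
    rw [← Isogeny.coe_toAddMonoidHom, ← AddMonoidHom.mem_ker, hkerφ]
  -- `φ (σ P) = φ P` for every `σ`
  have hσP : ∀ σ : Field.absoluteGaloisGroup ℚ, φ (σ • P) = φ P := by
    intro σ
    have hmem : σ • P - P ∈ AddSubgroup.zmultiples P := by
      refine hgen _ ?_
      rw [map_sub, ψ.map_smul, hP0, smul_zero, sub_zero]
    have hkill : (2 : ℤ) • (σ • P - P) = 0 := by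
      rw [zsmul_sub, ← galois_smul_zsmul W σ 2 P, hTσ σ, sub_self]
    have h0 : φ (σ • P - P) = 0 := by
      rw [hmemφ]
      rcases eq_zero_or_eq_two_zsmul_of_mem_zmultiples hPo hmem hkill with h | h
      · rw [h]; exact zero_mem _
      · rw [h]; exact AddSubgroup.mem_zmultiples _
    rwa [map_sub, sub_eq_zero] at h0
  -- `ℚ(E_0[2]) = ℚ`
  rw [hkerW, eq_comm, ker_galoisRepTorsion_eq_top_iff]
  intro σ P' hP'
  obtain ⟨R, rfl⟩ := φ.surjective P'
  rw [← φ.map_smul]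
  have h2R : φ ((2 : ℤ) • R) = 0 := by rw [map_zsmul, hP']
  rw [hmemφ] at h2R
  rcases eq_zero_or_eq_of_mem_zmultiples_of_two_zsmul hT0 hT2 h2R with h | h
  · rw [hfix σ R h]
  · have hRP : (2 : ℤ) • (R - P) = 0 := by rw [zsmul_sub, h, sub_self]
    have hσ : σ • (R - P) = R - P := hfix σ _ hRP
    rw [smul_sub] at hσ
    have e : σ • R = (R - P) + σ • P := by rw [← hσ, sub_add_cancel]
    rw [e, map_add, map_sub, hσP σ, sub_add_cancel]

/-- **A balanced isogeny on a curve with full rational `2`-torsion yields a cyclic degree-`4`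
isogeny over `ℚ`.** If `φ : E → E_0` is balanced, `ℚ(E_0[2]) = ℚ(E[2]) = ℚ`; with
`ker φ = {O, S}` and `2Q = S`, the point `Q' = φ(Q)` is a rational point of order `2` on `E_0`,
the quotient `φ₂ : E_0 → E'' = E_0/⟨Q'⟩` is defined over `ℚ` (Silverman, *AEC*, III.4.12), and
`ψ = φ₂ ∘ φ : E → E''` has kernel `{R : φ R ∈ {O, Q'}} = {O, S, Q, Q + S} = ⟨Q⟩ ≅ ℤ/4ℤ`.
[cite: Smith2022SelmerTwistI, Assumption 1.1] [cite: SilvermanAEC2009, Prop. III.4.12] -/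
theorem exists_isCyclic_of_isBalanced (h4 : ratTwoTorsionCard W = 4) {W₀ : WeierstrassCurve ℚ}
    [W₀.IsElliptic] (φ : Isogeny W W₀) (hb : φ.IsBalanced) :
    ∃ (W'' : WeierstrassCurve ℚ) (_ : W''.IsElliptic) (ψ : Isogeny W W''),
      ψ.IsCyclic ∧ ψ.degree = 4 := by
  have hkerW := ker_galoisRepTorsion_two_eq_top_of_ratTwoTorsionCard_eq_four W h4
  have hker₀ : (W₀.galoisRepTorsion 2).ker = ⊤ := by rw [← hb.2, hkerW]
  have hfix₀ := (ker_galoisRepTorsion_eq_top_iff W₀ 2).mp hker₀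
  obtain ⟨S, hS0, hS2, hkerφ⟩ := Isogeny.exists_ker_eq_pair_of_degree_eq_two φ hb.1
  have hS2' : (2 : ℤ) • S = 0 := by exact_mod_cast hS2
  -- `Q` with `2Q = S`, and `Q' = φ Q ∈ E_0[2]`, `Q' ≠ O`
  obtain ⟨Q, hQ⟩ := zsmul_geomPoints_surjective_holds W (n := 2) two_ne_zero S
  simp only at hQ
  have hQ'2 : (2 : ℤ) • φ Q = 0 := by rw [← map_zsmul, hQ, (hkerφ S).mpr (Or.inr rfl)]
  have hQ0 : Q ≠ 0 := by
    rintro rfl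
    exact hS0 (by rw [← hQ, zsmul_zero])
  have hQS : Q ≠ S := by
    rintro rfl
    exact hS0 (by rw [← hQ, hS2'])
  have hQ'0 : φ Q ≠ 0 := by
    intro h
    rcases (hkerφ Q).mp h with h' | h'
    · exact hQ0 h'
    · exact hQS h'
  set Qt : geomTorsion W₀ (2 : ℤ) := ⟨φ Q, (Submodule.mem_torsionBy_iff _ _).mpr hQ'2⟩
    with hQt_def
  have hQt0 : Qt ≠ 0 := fun e ↦ hQ'0 (congrArg Subtype.val e)
  have hQt : ∀ σ : Field.absoluteGaloisGroup ℚ, σ • Qt = Qt := fun σ ↦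
    Subtype.ext (hfix₀ σ _ hQ'2)
  obtain ⟨W'', hW'', φ₂, -, hker₂, hdeg₂, -, -⟩ := exists_isogeny_degree_two_of_fixed W₀ hQt0 hQt
  -- kernel of `φ₂`: `{O, Q'}`
  have hker₂' : ∀ X, φ₂ X = 0 ↔ X = 0 ∨ X = φ Q := by
    intro X
    rw [← Isogeny.coe_toAddMonoidHom, ← AddMonoidHom.mem_ker, hker₂]
    constructor
    · exact eq_zero_or_eq_of_mem_zmultiples_of_two_zsmul hQ'0 hQ'2
    · rintro (rfl | rfl)
      · exact zero_mem _
      · exact AddSubgroup.mem_zmultiples _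
  -- kernel of `ψ = φ₂ ∘ φ`: `⟨Q⟩`
  have hQψ : φ₂.comp φ Q = 0 := by
    rw [Isogeny.comp_apply, hker₂']
    exact Or.inr rfl
  have hkerψ : (φ₂.comp φ).toAddMonoidHom.ker = AddSubgroup.zmultiples Q := by
    refine le_antisymm (fun R hR ↦ ?_) (AddSubgroup.zmultiples_le.mpr ?_)
    · rw [AddMonoidHom.mem_ker, Isogeny.coe_toAddMonoidHom, Isogeny.comp_apply, hker₂'] at hR
      rw [AddSubgroup.mem_zmultiples_iff]
      rcases hR with h | h
      · rcases (hkerφ R).mp h with rfl | rfl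
        · exact ⟨0, zero_zsmul _⟩
        · exact ⟨2, hQ⟩
      · have h' : φ (R - Q) = 0 := by rw [map_sub, h, sub_self]
        rcases (hkerφ _).mp h' with h'' | h''
        · exact ⟨1, by rw [one_zsmul]; exact (sub_eq_zero.mp h'').symm⟩
        · refine ⟨3, ?_⟩
          rw [show (3 : ℤ) = 2 + 1 by norm_num, add_zsmul, one_zsmul, hQ, ← h'', sub_add_cancel]
    · rw [AddMonoidHom.mem_ker, Isogeny.coe_toAddMonoidHom]
      exact hQψ
  have hQo : addOrderOf Q = 4 := by
    have h1 : ¬ (2 ^ 1) • Q = 0 := by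
      rw [pow_one]
      intro h
      apply hS0
      rw [← hQ]
      exact_mod_cast h
    have h2 : (2 ^ (1 + 1)) • Q = 0 := by
      have : (2 : ℤ) • (2 : ℤ) • Q = 0 := by rw [hQ, hS2']
      rw [← mul_zsmul] at this
      exact_mod_cast this
    have := addOrderOf_eq_prime_pow h1 h2
    simpa using this
  refine ⟨W'', hW'', φ₂.comp φ, ?_, ?_⟩
  · change IsAddCyclic (φ₂.comp φ).toAddMonoidHom.ker
    rw [hkerψ]
    infer_instance
  · change Nat.card (φ₂.comp φ).toAddMonoidHom.ker = 4
    rw [hkerψ, Nat.card_zmultiples, hQo]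

/-- **For `E(ℚ)[2] ≅ (ℤ/2ℤ)²`: no cyclic degree-`4` isogeny over `ℚ` ⟺ no balanced isogeny**, i.e.
branch (3) of [Smi22a], Assumption 1.1 is the second branch of Case I of arXiv:2503.17619,
Def. 1.6. [cite: Smith2022SelmerTwistI, Assumption 1.1] [cite: arXiv250317619, Def. 1.6] -/
theorem forall_not_isBalanced_iff_forall_not_isCyclic (h4 : ratTwoTorsionCard W = 4) :
    (∀ (W₀ : WeierstrassCurve ℚ) [W₀.IsElliptic] (φ : Isogeny W W₀), ¬ φ.IsBalanced) ↔
      ∀ (W'' : WeierstrassCurve ℚ) [W''.IsElliptic] (ψ : Isogeny W W''),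
        ψ.IsCyclic → ψ.degree ≠ 4 := by
  constructor
  · intro h W'' _ ψ hc hd
    obtain ⟨W₀, _, φ, hb⟩ := exists_isBalanced_of_isCyclic W h4 ψ hc hd
    exact h W₀ φ hb
  · intro h W₀ _ φ hb
    obtain ⟨W'', _, ψ, hc, hd⟩ := exists_isCyclic_of_isBalanced W h4 φ hb
    exact h W'' ψ hc hd

end CyclicFour

/-! ## §4 Assumption 1.1 ⟺ Case I ∨ Case II -/

section Equivalence

variable (W : WeierstrassCurve ℚ) [W.IsElliptic]

/-- **[Smi22a], Assumption 1.1 holds for `E` iff `E` is in Case I or Case II of arXiv:2503.17619,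
Def. 1.6** — the hypothesis check behind *"If `E` is in Case I or Case II, Theorem 1.1 follows
for `E` from [Smi22a]"* (arXiv:2503.17619, §1.1): branch (1) is the first branch of Case I;
branch (2) is Case II (§2); branch (3) is the second branch of Case I (§3).
[cite: Smith2022SelmerTwistI, Assumption 1.1] [cite: arXiv250317619, Def. 1.6 and §1.1] -/
theorem smi22aAssumption_iff_smithCaseI_or_smithCaseII :
    smi22aAssumption W ↔ smithCaseI W ∨ smithCaseII W := by
  constructor
  · rintro (h1 | ⟨h2, h⟩ | ⟨h4, h⟩)
    · exact Or.inl (Or.inl h1)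
    · exact Or.inr (smithCaseII_of_forall W h2 h)
    · exact Or.inl (Or.inr ⟨h4,
        (forall_not_isBalanced_iff_forall_not_isCyclic W h4).mpr h⟩)
  · rintro ((h1 | ⟨h4, h⟩) | hII)
    · exact smi22aAssumption_of_ratTwoTorsionCard_eq_one h1
    · exact smi22aAssumption_of_ratTwoTorsionCard_eq_four h4
        ((forall_not_isBalanced_iff_forall_not_isCyclic W h4).mp h)
    · exact smi22aAssumption_of_ratTwoTorsionCard_eq_two hII.1
        (fun W₀ _ φ hφ ↦ forall_of_smithCaseII W hII W₀ φ hφ)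

/-- Case I ⟹ Assumption 1.1. [cite: Smith2022SelmerTwistI, Assumption 1.1] -/
theorem smi22aAssumption_of_smithCaseI (h : smithCaseI W) : smi22aAssumption W :=
  (smi22aAssumption_iff_smithCaseI_or_smithCaseII W).mpr (Or.inl h)

/-- Case II ⟹ Assumption 1.1. [cite: Smith2022SelmerTwistI, Assumption 1.1] -/
theorem smi22aAssumption_of_smithCaseII (h : smithCaseII W) : smi22aAssumption W :=
  (smi22aAssumption_iff_smithCaseI_or_smithCaseII W).mpr (Or.inr h)

/-- Assumption 1.1 excludes Cases III, IV and V (it implies Case I or II, and the five cases are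
… exhaustive; here only the implication is recorded). [cite: Smith2022SelmerTwistI, Assumption 1.1] -/
theorem smithCaseI_or_smithCaseII_of_smi22aAssumption (h : smi22aAssumption W) :
    smithCaseI W ∨ smithCaseII W :=
  (smi22aAssumption_iff_smithCaseI_or_smithCaseII W).mp h

end Equivalence

/-! ## §4b The five cases of Def. 1.6 are mutually exclusive; Assumption 1.1 ⟺ "no balanced
isogeny and not Case III" -/

section Exclusive

variable (W : WeierstrassCurve ℚ) [W.IsElliptic]

/-- A curve with `#E(ℚ)[2] = 1` has no balanced (indeed no degree-`2`) isogeny. [folklore] -/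
theorem not_isBalanced_of_ratTwoTorsionCard_eq_one (h1 : ratTwoTorsionCard W = 1)
    {W₀ : WeierstrassCurve ℚ} (φ : Isogeny W W₀) : ¬ φ.IsBalanced := fun hb ↦
  Isogeny.ratTwoTorsionCard_ne_one_of_degree_eq_two W φ hb.1 h1

/-- **A curve in Case I has no balanced isogeny.** [cite: arXiv250317619, Def. 1.6] -/
theorem not_isBalanced_of_smithCaseI (h : smithCaseI W) (W₀ : WeierstrassCurve ℚ) [W₀.IsElliptic]
    (φ : Isogeny W W₀) : ¬ φ.IsBalanced := by
  rcases h with h1 | ⟨-, h⟩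
  · exact not_isBalanced_of_ratTwoTorsionCard_eq_one W h1 φ
  · exact h W₀ φ

/-- **A curve in Case II has no balanced isogeny** (all its degree-`2` quotients have the same
`ℚ(E_0[2]) ≠ ℚ(E[2])`, §1–§2). [cite: arXiv250317619, Def. 1.6] -/
theorem not_isBalanced_of_smithCaseII (h : smithCaseII W) (W₀ : WeierstrassCurve ℚ)
    [W₀.IsElliptic] (φ : Isogeny W W₀) : ¬ φ.IsBalanced := fun hb ↦
  (forall_of_smithCaseII W h W₀ φ hb.1).2 hb.2.symm

/-- **A curve in Case III has no balanced isogeny**: its degree-`2` quotients have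
`ℚ(E_0[2]) = ℚ ≠ ℚ(E[2])` (as `#E(ℚ)[2] = 2`). [cite: arXiv250317619, Def. 1.6] -/
theorem not_isBalanced_of_smithCaseIII (h : smithCaseIII W) (W₁ : WeierstrassCurve ℚ)
    [W₁.IsElliptic] (φ : Isogeny W W₁) : ¬ φ.IsBalanced := by
  rintro ⟨hd, hk⟩
  obtain ⟨h2, W₀, _, φ₀, hd₀, hc⟩ := h
  have hk₀ := ker_galoisRepTorsion_two_eq_top_of_ratTwoTorsionCard_eq_four W₀ hc
  have hk₁ : (W₁.galoisRepTorsion 2).ker = (W₀.galoisRepTorsion 2).ker :=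
    ker_galoisRepTorsion_eq_of_degree_eq_two W h2 φ φ₀ hd hd₀ 2
  have h4 := ratTwoTorsionCard_eq_four_of_ker_eq_top W (by rw [hk, hk₁, hk₀])
  omega

omit [W.IsElliptic] in
/-- Cases I and II are disjoint. [cite: arXiv250317619, Def. 1.6] -/
theorem not_smithCaseII_of_smithCaseI (h : smithCaseI W) : ¬ smithCaseII W := by
  rintro ⟨h2, -⟩
  rcases h with h1 | ⟨h4, -⟩ <;> omega

omit [W.IsElliptic] in
/-- Cases I and III are disjoint. [cite: arXiv250317619, Def. 1.6] -/
theorem not_smithCaseIII_of_smithCaseI (h : smithCaseI W) : ¬ smithCaseIII W := by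
  rintro ⟨h2, -⟩
  rcases h with h1 | ⟨h4, -⟩ <;> omega

/-- Cases II and III are disjoint: their degree-`2` quotients would have both `ℚ(E_0[2]) ≠ ℚ`
and `#E_0(ℚ)[2] = 4`. [cite: arXiv250317619, Def. 1.6] -/
theorem not_smithCaseIII_of_smithCaseII (h : smithCaseII W) : ¬ smithCaseIII W := by
  rintro ⟨-, W₀, _, φ, hd, hc⟩
  exact (forall_of_smithCaseII W h W₀ φ hd).1
    (ker_galoisRepTorsion_two_eq_top_of_ratTwoTorsionCard_eq_four W₀ hc)

/-- Cases I and IV are disjoint. [cite: arXiv250317619, Def. 1.6] -/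
theorem not_smithCaseIV_of_smithCaseI (h : smithCaseI W) : ¬ smithCaseIV W := by
  rintro ⟨⟨W₀, _, φ, hb⟩, -⟩
  exact not_isBalanced_of_smithCaseI W h W₀ φ hb

/-- Cases I and V are disjoint. [cite: arXiv250317619, Def. 1.6] -/
theorem not_smithCaseV_of_smithCaseI (h : smithCaseI W) : ¬ smithCaseV W := by
  rintro ⟨W₁, W₂, _, _, φ₁, φ₂, hb₁, -, -⟩
  exact not_isBalanced_of_smithCaseI W h W₁ φ₁ hb₁

/-- Cases II and IV are disjoint. [cite: arXiv250317619, Def. 1.6] -/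
theorem not_smithCaseIV_of_smithCaseII (h : smithCaseII W) : ¬ smithCaseIV W := by
  rintro ⟨⟨W₀, _, φ, hb⟩, -⟩
  exact not_isBalanced_of_smithCaseII W h W₀ φ hb

/-- Cases II and V are disjoint. [cite: arXiv250317619, Def. 1.6] -/
theorem not_smithCaseV_of_smithCaseII (h : smithCaseII W) : ¬ smithCaseV W := by
  rintro ⟨W₁, W₂, _, _, φ₁, φ₂, hb₁, -, -⟩
  exact not_isBalanced_of_smithCaseII W h W₁ φ₁ hb₁

/-- Cases III and IV are disjoint. [cite: arXiv250317619, Def. 1.6] -/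
theorem not_smithCaseIV_of_smithCaseIII (h : smithCaseIII W) : ¬ smithCaseIV W := by
  rintro ⟨⟨W₀, _, φ, hb⟩, -⟩
  exact not_isBalanced_of_smithCaseIII W h W₀ φ hb

/-- Cases III and V are disjoint. [cite: arXiv250317619, Def. 1.6] -/
theorem not_smithCaseV_of_smithCaseIII (h : smithCaseIII W) : ¬ smithCaseV W := by
  rintro ⟨W₁, W₂, _, _, φ₁, φ₂, hb₁, -, -⟩
  exact not_isBalanced_of_smithCaseIII W h W₁ φ₁ hb₁

/-- **Def. 1.6 is a partition**: together with `smithCase_exhaustive` and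
`not_smithCaseV_of_smithCaseIV` (`BSDSelmerSmithCases…`), the ten pairwise exclusions above say
that every elliptic curve over `ℚ` lies in exactly one of Cases I–V. Recorded here as: Case I or
Case II holds iff none of Cases III, IV, V does. [cite: arXiv250317619, Def. 1.6] -/
theorem smithCaseI_or_smithCaseII_iff_not :
    smithCaseI W ∨ smithCaseII W ↔ ¬ smithCaseIII W ∧ ¬ smithCaseIV W ∧ ¬ smithCaseV W := by
  constructor
  · rintro (h | h)
    · exact ⟨not_smithCaseIII_of_smithCaseI W h, not_smithCaseIV_of_smithCaseI W h,
        not_smithCaseV_of_smithCaseI W h⟩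
    · exact ⟨not_smithCaseIII_of_smithCaseII W h, not_smithCaseIV_of_smithCaseII W h,
        not_smithCaseV_of_smithCaseII W h⟩
  · rintro ⟨h3, h4, h5⟩
    rcases smithCase_exhaustive W with h | h | h | h | h
    · exact Or.inl h
    · exact Or.inr h
    · exact absurd h h3
    · exact absurd h h4
    · exact absurd h h5

/-- **[Smi22a], Assumption 1.1 ⟺ `E` is in none of Cases III, IV, V** of arXiv:2503.17619 —
the precise sense in which arXiv:2503.17619 removes the assumptions of [Smi22a] ("The main goal
of this paper is to establish this theorem for Cases IV and V … This result implies that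
Theorem 1.1 holds for curves in Case III, the one remaining case", §1.1).
[cite: Smith2022SelmerTwistI, Assumption 1.1] [cite: arXiv250317619, §1.1] -/
theorem smi22aAssumption_iff_not_smithCaseIII_IV_V :
    smi22aAssumption W ↔ ¬ smithCaseIII W ∧ ¬ smithCaseIV W ∧ ¬ smithCaseV W :=
  (smi22aAssumption_iff_smithCaseI_or_smithCaseII W).trans (smithCaseI_or_smithCaseII_iff_not W)

/-- **[Smi22a], Assumption 1.1 ⟺ "`E` has no balanced isogeny and is not in Case III"**
(arXiv:2503.17619, §1.1: "For that theorem, we needed to assume that `E` did not have a balanced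
isogeny"; Case III is the residual case handled by an isogeny).
[cite: Smith2022SelmerTwistI, Assumption 1.1] [cite: arXiv250317619, §1.1] -/
theorem smi22aAssumption_iff_forall_not_isBalanced :
    smi22aAssumption W ↔
      (∀ (W₀ : WeierstrassCurve ℚ) [W₀.IsElliptic] (φ : Isogeny W W₀), ¬ φ.IsBalanced) ∧
        ¬ smithCaseIII W := by
  rw [smi22aAssumption_iff_smithCaseI_or_smithCaseII]
  constructor
  · rintro (h | h)
    · exact ⟨not_isBalanced_of_smithCaseI W h, not_smithCaseIII_of_smithCaseI W h⟩
    · exact ⟨not_isBalanced_of_smithCaseII W h, not_smithCaseIII_of_smithCaseII W h⟩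
  · rintro ⟨hnb, h3⟩
    rcases smithCase_exhaustive W with h | h | h | ⟨⟨W₀, _, φ, hb⟩, -⟩ |
        ⟨W₁, W₂, _, _, φ₁, φ₂, hb₁, -, -⟩
    · exact Or.inl h
    · exact Or.inr h
    · exact absurd h h3
    · exact absurd hb (hnb W₀ φ)
    · exact absurd hb₁ (hnb W₁ φ₁)

end Exclusive

/-! ## §5 Thm. 1.1 of arXiv:2503.17619 from [Smi22a], Thm. 1.2 verbatim -/

section Assembly

open Filter Topology
open Literature.NumberTheory.EllipticCurves.ModularForms

/-- **[Smi22a], Thm. 1.2 in the tree's density language.** If, for every elliptic `A/ℚ`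
satisfying Assumption 1.1 and every `r ≥ 0`, the printed limit
`lim_H #{d ∈ ℤ, d ≠ 0, |d| ≤ H : r_{2^∞}(A^d) = r}/(2H)` is `1/2` for `r ≤ 1` and `0` for `r ≥ 2`,
then `smith_selmerCorank_density A` (density over squarefree `d`) holds for every such `A`
(`smith_selmerCorank_density_iff_printed`, `BSDSelmerSmithNormalisationProofs`).
[cite: Smith2022SelmerTwistI, Thm. 1.2] -/
theorem smith_selmerCorank_density_of_smi22a_printed
    (h22 : ∀ (A : WeierstrassCurve ℚ) [A.IsElliptic], smi22aAssumption A → ∀ r : ℕ,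
      Tendsto (fun H : ℕ ↦ (Nat.card {d : ℤ | d ≠ 0 ∧ |d| ≤ (H : ℤ) ∧
        selmerCorankTwoInfty (A.quadraticTwist d) = r} : ℝ) / (2 * H)) atTop
        (𝓝 (if r ≤ 1 then 1 / 2 else 0)))
    (A : WeierstrassCurve ℚ) [A.IsElliptic] (hA : smi22aAssumption A) :
    smith_selmerCorank_density A := by
  rw [smith_selmerCorank_density_iff_printed]
  refine ⟨by simpa using h22 A hA 0, by simpa using h22 A hA 1, fun r hr ↦ ?_⟩
  simpa [if_neg (show ¬ r ≤ 1 by omega)] using h22 A hA r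

/-- **Smith's Theorem 1.1 (arXiv:2503.17619) for every elliptic curve over `ℚ`, from the printed
leaves with [Smi22a] entering verbatim.** Hypotheses:
`h22` — A. Smith, arXiv:2207.05674, **Thm. 1.2** as printed: for every elliptic `A/ℚ` satisfying
**Assumption 1.1** (`smi22aAssumption`) and `r ≥ 0`,
`lim_{H → ∞} #{d ∈ ℤ^{≠0} : |d| ≤ H, r_{2^∞}(A^d) = r}/(2H) = 1/2, 1/2, 0` (`r = 0`, `r = 1`,
`r ≥ 2`); `h17IV`, `h17V` — the two printed conclusions of arXiv:2503.17619, Thm. 1.17;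
`hmod` (`exists_isNewformOf`, Modularity) and `hMon` (`monsky_selmerCorank_two_mod_two_eq`,
`2`-parity) — existing tree facts for the parity half. The [Smi22a] input of the assembly
`smith_selmerCorank_density_of_printed_inputs'` ("Thm. 1.1 for curves in Case I or II") is
supplied by `h22` through `smi22aAssumption_iff_smithCaseI_or_smithCaseII` (§4) and the
normalisation bridge (§5). [cite: arXiv250317619, Thm. 1.1 (proof, §1.1)]
[cite: Smith2022SelmerTwistI, Thm. 1.2 and Assumption 1.1] -/
theorem smith_selmerCorank_density_of_smi22a
    (hmod : exists_isNewformOf) (hMon : monsky_selmerCorank_two_mod_two_eq)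
    (h22 : ∀ (A : WeierstrassCurve ℚ) [A.IsElliptic], smi22aAssumption A → ∀ r : ℕ,
      Tendsto (fun H : ℕ ↦ (Nat.card {d : ℤ | d ≠ 0 ∧ |d| ≤ (H : ℤ) ∧
        selmerCorankTwoInfty (A.quadraticTwist d) = r} : ℝ) / (2 * H)) atTop
        (𝓝 (if r ≤ 1 then 1 / 2 else 0)))
    (h17IV : ∀ (E E₀ : WeierstrassCurve ℚ) [E.IsElliptic] [E₀.IsElliptic] [E.IsCharNeTwoNF]
      [E₀.IsCharNeTwoNF] (φ : Isogeny E E₀) (φ' : Isogeny E₀ E),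
      smithCaseIV E → φ.IsBalanced → (∀ P, φ' (φ P) = (2 : ℤ) • P) →
        twistDensity (fun d ↦ d ≠ 0 ∧
          (selmerCorankTwoInfty (E.quadraticTwist d) ≤ 1 ∨
            (selmerCorankTwoInfty (E.quadraticTwist d) = φ.twistDivRank d ∧
              2 ≤ φ.twistDivRank d))) 1)
    (h17V : ∀ (E E₁ E₂ : WeierstrassCurve ℚ) [E.IsElliptic] [E₁.IsElliptic] [E₂.IsElliptic]
      [E.IsCharNeTwoNF] [E₁.IsCharNeTwoNF] [E₂.IsCharNeTwoNF] (φ₁ : Isogeny E E₁)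
      (φ₂ : Isogeny E E₂),
      smithCaseV E → φ₁.IsBalanced → φ₂.IsBalanced →
        φ₁.toAddMonoidHom.ker ≠ φ₂.toAddMonoidHom.ker →
        twistDensity (fun d ↦ d ≠ 0 ∧
          (selmerCorankTwoInfty (E.quadraticTwist d) ≤ 1 ∨
            (selmerCorankTwoInfty (E.quadraticTwist d) = φ₁.twistDivRank d ∧
              2 ≤ φ₁.twistDivRank d) ∨
            (selmerCorankTwoInfty (E.quadraticTwist d) = φ₂.twistDivRank d ∧
              2 ≤ φ₂.twistDivRank d))) 1)
    (E : WeierstrassCurve ℚ) [E.IsElliptic] : smith_selmerCorank_density E :=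
  smith_selmerCorank_density_of_printed_inputs' hmod hMon
    (fun A _ _ hA ↦ smith_selmerCorank_density_of_smi22a_printed h22 A
      ((smi22aAssumption_iff_smithCaseI_or_smithCaseII A).mpr hA))
    h17IV h17V E

end Assembly

/-! ## §6 Examples: Assumption 1.1 holds in Cases I, II and fails in each of Cases III, IV, V -/

section Examples

/-- The congruent number curve `y² = x³ - x` (Case I, `smithCaseI_example`) satisfies [Smi22a],
Assumption 1.1. [cite: Smith2022SelmerTwistI, Assumption 1.1] -/
theorem smi22aAssumption_example_caseI :
    smi22aAssumption (⟨0, 0, 0, -1, 0⟩ : WeierstrassCurve ℚ) := by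
  haveI := isElliptic_caseI_example
  exact smi22aAssumption_of_smithCaseI _ smithCaseI_example

/-- `y² = x³ + 2x` (Case II, `smithCaseII_example`) satisfies [Smi22a], Assumption 1.1 (branch
(2): `ℚ(E_0[2]) = ℚ(√8) ≠ ℚ, ℚ(√-2)`). [cite: Smith2022SelmerTwistI, Assumption 1.1] -/
theorem smi22aAssumption_example_caseII :
    smi22aAssumption (⟨0, 0, 0, 2, 0⟩ : WeierstrassCurve ℚ) := by
  haveI := isElliptic_caseII_example
  exact smi22aAssumption_of_smithCaseII _ smithCaseII_example

/-- `y² = x³ + 4x` (Case III, `smithCaseIII_example`) violates [Smi22a], Assumption 1.1: a curve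
to which arXiv:2503.17619, Thm. 1.1 applies but [Smi22a], Thm. 1.2 does not.
[cite: Smith2022SelmerTwistI, Assumption 1.1] [cite: arXiv250317619, §1.1] -/
theorem not_smi22aAssumption_example_caseIII :
    ¬ smi22aAssumption (⟨0, 0, 0, 4, 0⟩ : WeierstrassCurve ℚ) := by
  haveI := isElliptic_caseIII_example
  rw [smi22aAssumption_iff_not_smithCaseIII_IV_V]
  exact fun h ↦ h.1 smithCaseIII_example

/-- `y² = x(x - 1)(x - 4)` (Case IV, `smithCaseIV_example`; it carries the cyclic `4`-isogeny
through `E/⟨(0,0)⟩`) violates [Smi22a], Assumption 1.1.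
[cite: Smith2022SelmerTwistI, Assumption 1.1] [cite: arXiv250317619, §1.1] -/
theorem not_smi22aAssumption_example_caseIV :
    ¬ smi22aAssumption (⟨0, -5, 0, 4, 0⟩ : WeierstrassCurve ℚ) := by
  haveI := isElliptic_caseIV_example
  rw [smi22aAssumption_iff_not_smithCaseIII_IV_V]
  exact fun h ↦ h.2.1 smithCaseIV_example

/-- `y² = x(x - 25)(x - 9)` (Case V, `smithCaseV_example`, cf. `X₀(15)`-type curves) violates
[Smi22a], Assumption 1.1. [cite: Smith2022SelmerTwistI, Assumption 1.1] [cite: arXiv250317619, §1.1] -/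
theorem not_smi22aAssumption_example_caseV :
    ¬ smi22aAssumption (⟨0, -34, 0, 225, 0⟩ : WeierstrassCurve ℚ) := by
  haveI := isElliptic_caseV_example
  rw [smi22aAssumption_iff_not_smithCaseIII_IV_V]
  exact fun h ↦ h.2.2 smithCaseV_example

end Examples

end Literature.NumberTheory.EllipticCurves

end
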